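import Summits.AtomisticToContinuum.BoseEinsteinCondensation.Theorems.BECThomsonPrincipleGDTransferSeededIntegrableClosed
import Summits.AtomisticToContinuum.BoseEinsteinCondensation.Theorems.BECConjugateDominationHardCoreExtensionTruncationReduction

/-!
# Route `BECThomsonPrinciple`, crux `GDTransfer` (stmt-AtomisticToContinuum-9482), line `seeded-continuity`:
# sixth Defs file — the INTEGRABLE (Born-finite) re-cut by COMPACTNESS TRANSPORT (lead c4, skeleton v8)

`Defs` file (D-0016) continuing `…SeededDefs` (p137609), `…SeededWitnessDefs` (p139431), `…SeededRoughDefs`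
(p147682), `…SeededTransportDefs` (p153539) and `…SeededIntegrableDefs` (p157332).  Skeleton v7.1 (composition
`…SeededIntegrableClosed` p159668) leaves two registered stubs: the SEED `stub_noBalancedCat` and
`stub_hardCoreRest` (profiles not a.e. equal to an admissible profile that is finite on `[0, ∞)` with
SQUARE-integrable lift).  Skeleton v8 re-cuts the latter at INTEGRABILITY OF THE LIFT (`∫_{ℝ³} v(|x|) dx < ∞`,
Fournais' standing Assumption 1.1, the Born-finite class):

* Band emptiness needs no change: the plain-pair witness family `weightedFamily_of_plain_int` (p159291) already
  asks only finiteness on `[0, ∞)` and an integrable lift (`bandEmptiness_of_integrable` below, three lines over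
  landed theorems); so does near-minimiser phase stability `NearMinPhaseInt` (p157814, integrable Ky Fan gap).
* The ONE consumer of square-integrability in v7 was the side transport of `stub_localConstancyInt` (the
  Hölder–Sobolev pair-potential bound needs the dilation defect in `L^{3/2}(ℝ³)`).  v8 replaces it by a
  COMPACTNESS transport that needs no integrability exponent above `1`:
  (U) `EnergyUpperL1` — upper semicontinuity `E₀(b⁻²v(·/b), N, L) ≤ E₀(v, N, L) + ε` for `b` near `1` (one fixed
      `C¹` near-minimiser of `v`, bounded on the cell, against the `L¹`-small dilation defect);
  (A) `AEDilationL1` — along every sequence `b_k → 1` a subsequence of the scaled pair interactions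
      `Σ_{i<j} (b⁻²v(·/b))^per(xᵢ − xⱼ)` converges to `Σ_{i<j} v^per(xᵢ − xⱼ)` for a.e. configuration
      (`L¹`-continuity of dilations, finitely many lattice images, countably many null sets);
  (C) `CompactLimitAE` — Rellich + Fatou with a.e.-convergent pair interactions: `C¹` Bose states `Ψ_k` at fixed
      `(N, L)` with `E_{w_k}[Ψ_k] ≤ C + o(1)` have a subsequence converging in `L²((ℝ/ℤ)^{3N})` (free form-domain
      embedding of `PeriodicFormDomain`) to a unit Bose-symmetric `η` with MAXIMAL-form energy `Q_v(η) ≤ C`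
      (the landed `exists_limitProfile_of_seq` is the monotone-tower case);
  (D) `DilateCompactL1` — near-minimisers of the scaled potentials `b⁻²v(·/b)` at `(N, L)`, `b` near `1`, are
      `L²(cell^N)`-close to near-minimisers of `v` at `(N, L)` (contradiction + (U) + (A) + (C) + the landed
      max-form approximation `NearMinTower.stub_maxFormApproximationFiniteRange`);
  (L) `stub_localConstancyL1` — `LocalConstancy v` for every admissible `v` finite on `[0, ∞)` with integrable
      lift, from (D), `NearMinPhaseInt`, `CountLaw` and the dilation invariance of the law (`hiMass_dilate`).
* `stub_nonIntegrableRest` [crux-sized, open]: admissible profiles NOT a.e. equal to an admissible integrable one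
  — by `isEssIntegrableProfile_iff` below EXACTLY the profiles with `∫_{ℝ³} v(|x|) dx = ∞` (hard cores on a set
  of positive measure; non-integrable soft cores `r^{-α}𝟙[r ≤ R]`, `α ≥ 3`): the Born-infinite class, where the
  plain witnesses have infinite energy (dressing needed) and, at hard cores, fixed-volume uniqueness rests on the
  open `LemmaGConnected`.

Objects: `IsIntegrableProfile`, `IsEssIntegrableProfile`; statements `EnergyUpperL1`, `AEDilationL1`,
`CompactLimitAE`, `DilateCompactL1`; registered signatures `Sig.stub_energyUpperL1`, `Sig.stub_aeDilationL1`,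
`Sig.stub_compactLimitAE`, `Sig.stub_dilateCompactL1`, `Sig.stub_localConstancyL1`, `Sig.stub_nonIntegrableRest`;
glue `bandEmptiness_of_integrable`, `GDTransfer_of_compact` (sorry-free over the landed `stub_countLaw`,
`stub_freeCorner`, `stub_ivtGlue`, `stub_nearMinPhaseInt`, `stub_roughNull`, `stub_chordVariation`,
`stub_weightedWindowLaw`, `stub_bandFromWindow`); sanity `nonIntegrableRest_of_gdTransfer`,
`isIntegrableProfile_of_isSqIntegrableProfile`, `hardCoreRest_of_nonIntegrableRest` (v8 refines v7),
`isEssIntegrableProfile_iff`.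
Nothing open is asserted: every `def … : Prop` is consumed only as the type of a stub theorem or as a hypothesis.

References: LSSY2005 §1.2 (1.16), Ch. 2 (2.1); Fournais2020 Assumption 1.1, (1.1); ReedSimonIV1978 Thm XIII.64
(Rellich), §XIII.12; B. Simon, J. Operator Theory 1 (1979) 37–47 (maximal forms).
-/

noncomputable section

open MeasureTheory Filter UnitAddTorus
open scoped ENNReal NNReal Topology InnerProductSpace

namespace Summit.AtomisticToContinuum.BoseEinsteinCondensation.Cruxes.GDTransfer.Seeded

open Literature.MathematicalPhysics.QuantumManyBody.BoseGas
open Literature.Barriers.AtomisticToContinuum.BoseGas (scaledPotential)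
open Summit.AtomisticToContinuum.BoseEinsteinCondensation.Theses.BECThomsonPrinciple
open Summit.AtomisticToContinuum.BoseEinsteinCondensation.Cruxes.GDTransfer.DysonDressedWitness
  (PeriodicBECFor gdTransfer_iff stub_chordVariation)
open Summit.AtomisticToContinuum.BoseEinsteinCondensation.Cruxes.StaticResponseBound.UvThomsonForceWave
  (measurable_zeroProfile lintegral_periodicInteraction_zero_ne_top)

-- The measure on `ℝ/ℤ` is the Haar PROBABILITY measure, as in `PeriodicFormDomain.lean`.
attribute [local instance] Literature.MathematicalPhysics.QuantumManyBody.BoseGas.formDomain_measureSpace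
  Literature.MathematicalPhysics.QuantumManyBody.BoseGas.formDomain_isProbabilityMeasure
  Literature.MathematicalPhysics.QuantumManyBody.BoseGas.formDomain_isProbabilityMeasure_pi

/-! ## §0 Vocabulary -/

/-- INTEGRABLE profile (the Born-finite class; Fournais' Assumption 1.1 within the admissible class): finite on every
radius `r ≥ 0` and with radial lift `x ↦ v ‖x‖` in `L¹(ℝ³)`.  Square-integrable finite-range profiles are in it
(`isIntegrableProfile_of_isSqIntegrableProfile`). -/
def IsIntegrableProfile (v : ℝ → ℝ≥0∞) : Prop :=
  (∀ r, 0 ≤ r → v r ≠ ⊤) ∧ (∫⁻ x : Space, v ‖x‖) ≠ ⊤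

/-- ESSENTIALLY integrable profile: a.e. equal (as a radial lift on `ℝ³`) to an admissible integrable profile; for an
admissible `v` this is exactly `∫_{ℝ³} v(|x|) dx < ∞` (`isEssIntegrableProfile_iff`). -/
def IsEssIntegrableProfile (v : ℝ → ℝ≥0∞) : Prop :=
  ∃ w : ℝ → ℝ≥0∞, IsRepulsiveFiniteRange w ∧ IsIntegrableProfile w ∧ ∀ᵐ x : Space, v ‖x‖ = w ‖x‖

/-! ## §1 The statements of the compactness transport -/

/-- (U) **Upper semicontinuity of the ground-state energy under dilation of the profile**, integrable class: at fixed
`(N, L)`, for every `ε > 0`, `E₀(b⁻²v(·/b), N, L) ≤ E₀(v, N, L) + ε` for all `b` near `1`.  (One `C¹` near-minimiser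
of `v`, bounded on the cell, tested against the scaled potential; the dilation defect is small in `L¹(ℝ³)`.)  By the
exact covariance `periodicGroundStateEnergy_scaledPotential` this is upper semicontinuity of `L ↦ E₀(v, N, L)`. -/
def EnergyUpperL1 : Prop :=
  ∀ v : ℝ → ℝ≥0∞, IsRepulsiveFiniteRange v → (∀ r, 0 ≤ r → v r ≠ ⊤) → (∫⁻ x : Space, v ‖x‖) ≠ ⊤ →
    ∀ (m : ℕ) (L : ℝ), 0 < L → ∀ ε : ℝ, 0 < ε →
      ∃ ϑ : ℝ, 0 < ϑ ∧ ∀ b : ℝ, 0 < b → |b - 1| < ϑ →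
        periodicGroundStateEnergy (scaledPotential v b) (m + 1) L ≤
          periodicGroundStateEnergy v (m + 1) L + ENNReal.ofReal ε

/-- (A) **A.e. convergence of the scaled pair interactions along a subsequence**, integrable class: for every
sequence of dilation parameters `b_k → 1` some subsequence of the configuration-space pair interactions of
`b⁻²v(·/b)` converges to that of `v` at (Lebesgue-) almost every configuration. -/
def AEDilationL1 : Prop :=
  ∀ v : ℝ → ℝ≥0∞, IsRepulsiveFiniteRange v → (∀ r, 0 ≤ r → v r ≠ ⊤) → (∫⁻ x : Space, v ‖x‖) ≠ ⊤ →
    ∀ (N : ℕ) (L : ℝ), 0 < L → ∀ b : ℕ → ℝ, (∀ k, 0 < b k) → Tendsto b atTop (𝓝 1) →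
      ∃ φ : ℕ → ℕ, StrictMono φ ∧
        ∀ᵐ X : Config N, Tendsto (fun k => periodicInteraction (scaledPotential v (b (φ k))) L X) atTop
          (𝓝 (periodicInteraction v L X))

/-- (C) **Rellich + Fatou with a.e.-convergent pair interactions** (the landed `exists_limitProfile_of_seq` is the
monotone-tower case): at fixed `(N, L)`, `C¹` Bose trial states `Ψ_k` with `E_{w_k}[Ψ_k] ≤ C + e_k`, `e_k → 0`,
`e_k ≤ 1`, `C < ⊤`, for measurable profiles `w_k` whose pair interactions converge a.e. to that of `v`, have a
subsequence whose embedded classes (free form domain of `PeriodicFormDomain`) converge in `L²((ℝ/ℤ)^{3N})` to a unit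
`η`, Bose-symmetric in momentum space, of maximal-form energy `Q_v(η) ≤ C`. -/
def CompactLimitAE : Prop :=
  ∀ (N : ℕ) (L : ℝ) (hL : 0 < L) (v : ℝ → ℝ≥0∞), Measurable v →
    ∀ w : ℕ → ℝ → ℝ≥0∞, (∀ k, Measurable (w k)) →
    (∀ᵐ X : Config N, Tendsto (fun k => periodicInteraction (w k) L X) atTop
      (𝓝 (periodicInteraction v L X))) →
    ∀ C : ℝ≥0∞, C ≠ ⊤ → ∀ e : ℕ → ℝ≥0∞, (∀ k, e k ≤ 1) → Tendsto e atTop (𝓝 0) →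
    ∀ Ψ : ℕ → PeriodicTrialState N L, (∀ k, periodicEnergy (w k) (Ψ k) ≤ C + e k) →
      ∃ (η : Lp ℂ 2 (volume : Measure (UnitAddTorus (Fin N × Fin 3)))) (φ : ℕ → ℕ), StrictMono φ ∧
        Tendsto (fun i => formEmbed hL measurable_zeroProfile (lintegral_periodicInteraction_zero_ne_top N L)
          ⟨graphEmbed hL measurable_zeroProfile (lintegral_periodicInteraction_zero_ne_top N L)
            ⟨(Ψ (φ i)).ψ, (Ψ (φ i)).mem_periodicCore⟩, graphEmbed_mem_formDomain _ _ _ _⟩) atTop (𝓝 η) ∧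
        ‖η‖ = 1 ∧
        (∀ (σ : Equiv.Perm (Fin N)) (n : Fin N × Fin 3 → ℤ),
          ⟪(mFourierLp 2 (fun p : Fin N × Fin 3 => n (σ p.1, p.2)) :
              Lp ℂ 2 (volume : Measure (UnitAddTorus (Fin N × Fin 3)))), η⟫_ℂ =
            ⟪(mFourierLp 2 n : Lp ℂ 2 (volume : Measure (UnitAddTorus (Fin N × Fin 3)))), η⟫_ℂ) ∧
        ∑' n : Fin N × Fin 3 → ℤ, ENNReal.ofReal (∑ p, (2 * Real.pi * (n p : ℝ) / L) ^ 2) *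
            (‖⟪(mFourierLp 2 n : Lp ℂ 2 (volume : Measure (UnitAddTorus (Fin N × Fin 3)))), η⟫_ℂ‖₊ :
              ℝ≥0∞) ^ 2 +
          ∫⁻ t, periodicInteraction v L (fromUnitTorusN L t) *
            (‖(η : UnitAddTorus (Fin N × Fin 3) → ℂ) t‖₊ : ℝ≥0∞) ^ 2 ≤ C

/-- (D) **Near-minimisers of the scaled potentials are `L²`-close to near-minimisers of `v`**, integrable class, at
fixed `(N, L)`: for every `η > 0` and slack `δ₁ > 0` there are `ϑ > 0` and a slack `δ' > 0` such that for
`|b − 1| < ϑ` every `δ'`-near-minimiser of `b⁻²v(·/b)` is within `η` in `L²(cell^N)` of some `δ₁`-near-minimiser of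
`v`.  (Contradiction: along `b_k → 1`, (U) bounds the energies, (A)+(C) extract an `L²`-limit of maximal-form
energy `≤ E₀(v)`, and the max-form approximation `stub_maxFormApproximationFiniteRange` puts a `C¹` near-minimiser
of `v` next to it.) -/
def DilateCompactL1 : Prop :=
  ∀ v : ℝ → ℝ≥0∞, IsRepulsiveFiniteRange v → (∀ r, 0 ≤ r → v r ≠ ⊤) → (∫⁻ x : Space, v ‖x‖) ≠ ⊤ →
    ∀ (m : ℕ) (L : ℝ), 0 < L → ∀ η : ℝ, 0 < η → ∀ δ₁ : ℝ≥0∞, 0 < δ₁ →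
      ∃ ϑ : ℝ, 0 < ϑ ∧ ∃ δ' : ℝ≥0∞, 0 < δ' ∧ ∀ b : ℝ, 0 < b → |b - 1| < ϑ →
        ∀ Φ : PeriodicTrialState (m + 1) L,
          periodicEnergy (scaledPotential v b) Φ ≤
              periodicGroundStateEnergy (scaledPotential v b) (m + 1) L + δ' →
          ∃ Ψ₁ : PeriodicTrialState (m + 1) L,
            periodicEnergy v Ψ₁ ≤ periodicGroundStateEnergy v (m + 1) L + δ₁ ∧
            ∫⁻ X in cellN (m + 1) L, (‖Φ.ψ X - Ψ₁.ψ X‖₊ : ℝ≥0∞) ^ 2 ≤ ENNReal.ofReal (η ^ 2)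

/-! ## §2 Registered stub signatures (skeleton v8) -/

/-- Registered signature of `stub_energyUpperL1` [M; a fixed bounded `C¹` near-minimiser of `v` against the scaled
potential, `L¹`-smallness of the dilation defect (`dil_integral_dilate_sub_le`),
`∫_{cell^N} w^per(x_p − x_q) ≤ C(N, L)‖w‖₁`]. -/
def Sig.stub_energyUpperL1 : Prop :=
  EnergyUpperL1

/-- Registered signature of `stub_aeDilationL1` [M; `L¹`-continuity of dilations ⇒ convergence in measure of the
lifts ⇒ a.e.-convergent subsequence on `ℝ³`; finitely many lattice images on bounded sets (uniform range `≤ 2R₀`);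
pull-back to pair differences `Negative.ae_pairDiff`]. -/
def Sig.stub_aeDilationL1 : Prop :=
  AEDilationL1

/-- Registered signature of `stub_compactLimitAE` [M–L; `exists_limitProfile_of_seq` with Fatou along the
a.e.-convergent interactions in place of Beppo Levi along the truncation tower]. -/
def Sig.stub_compactLimitAE : Prop :=
  CompactLimitAE

/-- Registered signature of `stub_dilateCompactL1` [L; contradiction + (U) + (A) + (C) + max-form approximation
`NearMinTower.stub_maxFormApproximationFiniteRange` + `norm_formEmbed_sub_sq_trialState`]. -/
def Sig.stub_dilateCompactL1 : Prop :=
  EnergyUpperL1 → CompactLimitAE → AEDilationL1 → DilateCompactL1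

/-- Registered signature of `stub_localConstancyL1` [M–L; c3's `stub_localConstancyInt` with the Sobolev transport
replaced by (D): dilate the near-minimiser at `L'` to `L₁` (`PeriodicTrialState.dilate`, exact covariance, same law
`hiMass_dilate`), put a near-minimiser of `v` at `L₁` next to it by (D), align phases by `NearMinPhaseInt`, compare
laws by `CountLaw` (2)]. -/
def Sig.stub_localConstancyL1 : Prop :=
  DilateCompactL1 → NearMinPhaseInt → CountLaw →
    ∀ v : ℝ → ℝ≥0∞, IsRepulsiveFiniteRange v → (∀ r, 0 ≤ r → v r ≠ ⊤) → (∫⁻ x : Space, v ‖x‖) ≠ ⊤ →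
      LocalConstancy v

/-- Registered signature of `stub_nonIntegrableRest` [crux-sized; the Born-infinite class `∫_{ℝ³} v(|x|) dx = ∞`
(`isEssIntegrableProfile_iff`): hard cores on a set of positive measure (plain witnesses have `⊤` energy, GD's chord
is silent there; fixed-volume uniqueness ⇐ `LemmaGConnected`) and non-integrable soft cores — given GD, the seed and
periodic BEC for the integrable class; implied by the crux (`nonIntegrableRest_of_gdTransfer`)]. -/
def Sig.stub_nonIntegrableRest : Prop :=
  GaussianDominationCan → NoBalancedCat →
    (∀ w : ℝ → ℝ≥0∞, IsRepulsiveFiniteRange w → IsIntegrableProfile w → PeriodicBECFor w) →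
    ∀ v : ℝ → ℝ≥0∞, IsRepulsiveFiniteRange v → ¬ IsEssIntegrableProfile v → PeriodicBECFor v

/-! ## §3 Composition (sorry-free): the v8 statements give the crux BY NAME -/

/-- **Band emptiness for the whole integrable class is already landed**: the plain pair is a weighted witness
family for every admissible profile finite on `[0, ∞)` with integrable lift (`weightedFamily_of_plain_int`), so
GD ⟶ two-sided dual norm ⟶ weighted window bound ⟶ band emptiness exactly as in `stub_bandEmptinessInt`. -/
theorem bandEmptiness_of_integrable (hG : GaussianDominationCan) (v : ℝ → ℝ≥0∞) (hv : IsRepulsiveFiniteRange v)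
    (hi : IsIntegrableProfile v) : BandEmptiness v :=
  stub_bandFromWindow v hv
    (stub_weightedWindowLaw (stub_chordVariation hG) v hv (weightedFamily_of_plain_int hv hi.1 hi.2))

/-- **The line (skeleton v8) concludes the crux BY NAME.**  Integrable profiles through the connectedness assembly
(count law, seed, band emptiness from GD, free corner, local constancy by the compactness transport); essentially
integrable profiles through the landed null-modification invariance `stub_roughNull`; the rest through
`stub_nonIntegrableRest` fed with that conclusion. -/
theorem GDTransfer_of_compact : Summit.AtomisticToContinuum.BoseEinsteinCondensation.Cruxes.GDTransfer.Seeded.Sig.stub_noBalancedCat → Summit.AtomisticToContinuum.BoseEinsteinCondensation.Cruxes.GDTransfer.Seeded.Sig.stub_energyUpperL1 → Summit.AtomisticToContinuum.BoseEinsteinCondensation.Cruxes.GDTransfer.Seeded.Sig.stub_aeDilationL1 → Summit.AtomisticToContinuum.BoseEinsteinCondensation.Cruxes.GDTransfer.Seeded.Sig.stub_compactLimitAE → Summit.AtomisticToContinuum.BoseEinsteinCondensation.Cruxes.GDTransfer.Seeded.Sig.stub_dilateCompactL1 → Summit.AtomisticToContinuum.BoseEinsteinCondensation.Cruxes.GDTransfer.Seeded.Sig.stub_localConstancyL1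 → Summit.AtomisticToContinuum.BoseEinsteinCondensation.Cruxes.GDTransfer.Seeded.Sig.stub_nonIntegrableRest → Summit.AtomisticToContinuum.BoseEinsteinCondensation.Theses.BECThomsonPrinciple.GDTransfer := by
  intro hSeed hUp hAE hCpt hDil hLoc hRest
  rw [gdTransfer_iff]
  intro hG v hv
  have hsoft : ∀ w : ℝ → ℝ≥0∞, IsRepulsiveFiniteRange w → IsIntegrableProfile w → PeriodicBECFor w :=
    fun w hw hi => stub_ivtGlue stub_countLaw hSeed w hw (bandEmptiness_of_integrable hG w hw hi)
      (stub_freeCorner w hw)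
      (hLoc (hDil hUp hCpt hAE) stub_nearMinPhaseInt stub_countLaw w hw hi.1 hi.2)
  by_cases hess : IsEssIntegrableProfile v
  · obtain ⟨w, hw, hwi, hae⟩ := hess
    exact stub_roughNull v w hv hw hae (hsoft w hw hwi)
  · exact hRest hG hSeed hsoft v hv hess

/-! ## §4 Sanity (sorry-free) -/

/-- The rest stub is a weakening of the crux (implied by it). -/
theorem nonIntegrableRest_of_gdTransfer (h : GDTransfer) : Sig.stub_nonIntegrableRest :=
  fun hG _ _ v hv _ => (gdTransfer_iff.mp h) hG v hv

/-- Square-integrable finite-range profiles are integrable (so skeleton v8's soft class contains v7's):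
`lintegral_le_of_sq`. -/
theorem isIntegrableProfile_of_isSqIntegrableProfile {v : ℝ → ℝ≥0∞} (hv : IsRepulsiveFiniteRange v)
    (h : IsSqIntegrableProfile v) : IsIntegrableProfile v :=
  ⟨h.1, lintegral_le_of_sq hv h.2⟩

/-- … hence essentially square-integrable profiles are essentially integrable. -/
theorem isEssIntegrableProfile_of_isEssSqIntegrableProfile {v : ℝ → ℝ≥0∞} (h : IsEssSqIntegrableProfile v) :
    IsEssIntegrableProfile v := by
  obtain ⟨w, hw, hwi, hae⟩ := h
  exact ⟨w, hw, isIntegrableProfile_of_isSqIntegrableProfile hw hwi, hae⟩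

/-- v8 refines v7: the v7 rest stub `stub_hardCoreRest` follows from the v8 rest stub, given the v8 soft conclusion
for the integrable class (which its own hypotheses GD + seed supply through the other v8 stubs; here taken as the
hypothesis `hsoftI`). -/
theorem hardCoreRest_of_nonIntegrableRest
    (hsoftI : GaussianDominationCan → NoBalancedCat →
      ∀ w : ℝ → ℝ≥0∞, IsRepulsiveFiniteRange w → IsIntegrableProfile w → PeriodicBECFor w)
    (hRest : Sig.stub_nonIntegrableRest) : Sig.stub_hardCoreRest := by
  intro hG hSeed _ v hv _
  by_cases hess : IsEssIntegrableProfile v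
  · obtain ⟨w, hw, hwi, hae⟩ := hess
    exact stub_roughNull v w hv hw hae (hsoftI hG hSeed w hw hwi)
  · exact hRest hG hSeed (hsoftI hG hSeed) v hv hess

/-- **The essentially integrable class is exactly the Born-finite class**: an admissible profile is a.e. equal to an
admissible integrable one iff its lift has finite integral over `ℝ³` (then the lift is finite a.e., and replacing
the value `⊤` by `0` gives an admissible integrable representative). -/
theorem isEssIntegrableProfile_iff {v : ℝ → ℝ≥0∞} (hv : IsRepulsiveFiniteRange v) :
    IsEssIntegrableProfile v ↔ (∫⁻ x : Space, v ‖x‖) ≠ ⊤ := by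
  constructor
  · rintro ⟨w, -, ⟨-, hwi⟩, hae⟩
    rwa [lintegral_congr_ae hae]
  · intro hint
    obtain ⟨hmeas, R₀, hR₀⟩ := hv
    -- the representative: `⊤` replaced by `0`
    refine ⟨fun r => if v r = ⊤ then 0 else v r, ⟨?_, R₀, fun r hr => by simp [hR₀ r hr]⟩,
      ⟨fun r _ => by dsimp only; split_ifs with h <;> simp [h], ?_⟩, ?_⟩
    · exact Measurable.ite (hmeas (measurableSet_singleton ⊤)) measurable_const hmeas
    · refine ne_top_of_le_ne_top hint (lintegral_mono fun x => ?_)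
      dsimp only
      split_ifs <;> simp
    · -- the lift is finite a.e. since its integral is finite
      have hfin : ∀ᵐ x : Space, v ‖x‖ < ⊤ :=
        ae_lt_top (hmeas.comp measurable_norm) hint
      filter_upwards [hfin] with x hx
      simp [hx.ne]

end Summit.AtomisticToContinuum.BoseEinsteinCondensation.Cruxes.GDTransfer.Seeded

end
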